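import Summits.ValiantsHypothesis.ValiantsHypothesis.Theorems.GrenetZeonDualUnipotentThreeHalvesLongMassNilSpaceSandwich

/-!
# `GrenetZeon.DualUnipotentThreeHalves` (stmt-ValiantsHypothesis-24318), line `slow_core`, stub (c) `SlowCore.LongMassSlowLawInv`:
# BY NAME — an `IrreducibleInv` constituent of size `≥ 2` has nil-index `≥ 3`

Sequel to ✓ `…LongMassNilSpaceSandwich` (chain sandwich law).  The registered research statement (c) quantifies over `IrreducibleInv` nilpotent
affine pencils `B` («no common invariant subspace of the point values `B(x)`», ✓ `SlowCore.IrreducibleInv`).  Here, in that exact vocabulary: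

* ★★ `pointMat_eq_zero_of_irreducibleInv_of_sq_eq_zero` — `IsAffine N`, `N ^ 2 = 0`, `IrreducibleInv N` ⇒ every point value `N(x)` is `0`
  (for `A = N(x)` the vectors killed by every `A·X`, `X` in the unital algebra of the point values, form an invariant subspace containing the
  columns of `A` (✓ `sq_zero_space_sandwich`: `A·X·A = 0`) and, through `X = 1`, contained in `ker A`; no Burnside theorem is used);
* ★★ `le_one_of_irreducibleInv_of_sq_eq_zero` — hence such a pencil has size `b ≤ 1`; `sq_ne_zero_of_irreducibleInv` — an `IrreducibleInv`
  affine pencil of size `b ≥ 2` is not square-zero: the irreducible constituents of (c) have nil-index `≥ 3`.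

HONEST FRAMING.  Support lemmas (`--supports stmt-ValiantsHypothesis-24318`); a structural fact about the (c)-enemy, NOT progress on (c)
`SlowCore.LongMassSlowLawInv` (RESEARCH — OPEN); closes no stub; S3, 24318, 8062 and `VP ≠ VNP` are NOT proved.  Def-free, no named facts, no sorry.
-/

set_option linter.dupNamespace false
set_option autoImplicit false

noncomputable section

namespace Summit.ValiantsHypothesis.ValiantsHypothesis.Theorems.GrenetZeon.NilSpaceSandwich

open Matrix
open scoped BigOperators
open Summit.ValiantsHypothesis.ValiantsHypothesis.Cruxes.TwoDimCoefficients.DimTwoCases (AffMat IsAffine)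
open Summit.ValiantsHypothesis.ValiantsHypothesis.Theorems.GrenetZeon.ResolventFlag (pointMat linMat)

variable {n m : ℕ}

/-! ## The invariant subspace attached to a square-zero `IrreducibleInv` pencil

The registered research statement (c) `SlowCore.LongMassSlowLawInv` quantifies over `IrreducibleInv` nilpotent affine
pencils — «no common invariant subspace of the point values `B(x)`».  By §3 of the sandwich file (✓ `sq_zero_space_sandwich`), such a pencil is never of index `2` (unless it is the zero pencil):
for `A = B(x)` the vectors killed by every `A·X`, `X` in the unital algebra of the point values, form an invariant subspace containing `range A`
and contained in `ker A`.  No Burnside theorem is needed. -/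

open Summit.ValiantsHypothesis.ValiantsHypothesis.Theorems.GrenetZeon.SlowCore (IrreducibleInv)

/-- ★★ **SQUARE-ZERO `IrreducibleInv` PENCILS VANISH.**  If `N` is affine, `N ^ 2 = 0` and the point values of `N` have no common invariant
subspace other than `⊥, ⊤` (`IrreducibleInv N`), then every point value is `0`. -/
theorem pointMat_eq_zero_of_irreducibleInv_of_sq_eq_zero (N : AffMat n m) (hN : IsAffine N) (h2 : N ^ 2 = 0)
    (hirr : IrreducibleInv N) (x : Fin n × Fin n → ℂ) : pointMat N x = 0 := by
  classical
  set V : Submodule ℂ (Matrix (Fin m) (Fin m) ℂ) := Submodule.span ℂ (Set.range (pointMat N)) with hV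
  have hVnil : ∀ X ∈ V, X ^ 2 = 0 := fun X hX => pow_eq_zero_of_mem_span_pointMat N hN h2 hX
  set 𝒜 : Subalgebra ℂ (Matrix (Fin m) (Fin m) ℂ) := Algebra.adjoin ℂ (Set.range (pointMat N)) with h𝒜
  have h𝒜V : 𝒜 ≤ Algebra.adjoin ℂ (V : Set (Matrix (Fin m) (Fin m) ℂ)) := Algebra.adjoin_mono Submodule.subset_span
  set A := pointMat N x with hA
  have hAV : A ∈ V := Submodule.subset_span ⟨x, rfl⟩
  have hAXA : ∀ X ∈ 𝒜, A * X * A = 0 := fun X hX => sq_zero_space_sandwich V hVnil hAV X (h𝒜V hX)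
  -- the subspace of vectors killed by every `A·X`, `X ∈ 𝒜`
  let U : Submodule ℂ (Fin m → ℂ) :=
    { carrier := {u | ∀ X ∈ 𝒜, (A * X).mulVec u = 0}
      add_mem' := fun {u v} hu hv X hX => by
        show (A * X).mulVec (u + v) = 0
        rw [Matrix.mulVec_add, hu X hX, hv X hX, add_zero]
      zero_mem' := fun X _ => Matrix.mulVec_zero _
      smul_mem' := fun c u hu X hX => by
        show (A * X).mulVec (c • u) = 0
        rw [Matrix.mulVec_smul, hu X hX, smul_zero] }
  have hUinv : ∀ y : Fin n × Fin n → ℂ, ∀ w ∈ U, (N.map (MvPolynomial.eval y)).mulVec w ∈ U := by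
    intro y w hw X hX
    show (A * X).mulVec ((pointMat N y).mulVec w) = 0
    rw [Matrix.mulVec_mulVec, Matrix.mul_assoc]
    exact hw (X * pointMat N y) (𝒜.mul_mem hX (Algebra.subset_adjoin ⟨y, rfl⟩))
  -- the columns of `A` lie in `U`
  have hcol : ∀ j : Fin m, A.mulVec (Pi.single j 1) ∈ U := by
    intro j X hX
    show (A * X).mulVec (A.mulVec (Pi.single j 1)) = 0
    rw [Matrix.mulVec_mulVec, hAXA X hX, Matrix.zero_mulVec]
  rcases hirr U hUinv with hbot | htop
  · -- `U = ⊥`: the columns of `A` vanish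
    refine Matrix.ext fun i j => ?_
    have h := hcol j
    rw [hbot, Submodule.mem_bot, Matrix.mulVec_single_one] at h
    have hij := congr_fun h i
    rwa [Matrix.col_apply] at hij
  · -- `U = ⊤`: `A = A·1` kills every vector
    refine Matrix.ext fun i j => ?_
    have h : (Pi.single j (1 : ℂ) : Fin m → ℂ) ∈ U := by rw [htop]; exact Submodule.mem_top
    have h1 := h 1 𝒜.one_mem
    rw [Matrix.mul_one, Matrix.mulVec_single_one] at h1
    have hij := congr_fun h1 i
    rwa [Matrix.col_apply] at hij

/-- ★★ **BY NAME: `IrreducibleInv` + index `≤ 2` forces size `≤ 1`.**  (With all point values `0`, every line `ℂ·e₀` is invariant.)  So the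
irreducible constituents over which (c) `SlowCore.LongMassSlowLawInv` quantifies have nil-index `≥ 3` as soon as `b ≥ 2`. -/
theorem le_one_of_irreducibleInv_of_sq_eq_zero (N : AffMat n m) (hN : IsAffine N) (h2 : N ^ 2 = 0) (hirr : IrreducibleInv N) :
    m ≤ 1 := by
  classical
  by_contra hm'
  have hm : 2 ≤ m := by omega
  have h0 : ∀ y, pointMat N y = 0 := pointMat_eq_zero_of_irreducibleInv_of_sq_eq_zero N hN h2 hirr
  -- the line spanned by `e₀` is invariant (all point values vanish) but neither `⊥` nor `⊤`
  set i0 : Fin m := ⟨0, by omega⟩ with hi0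
  set i1 : Fin m := ⟨1, by omega⟩ with hi1
  set L : Submodule ℂ (Fin m → ℂ) := Submodule.span ℂ {(Pi.single i0 (1 : ℂ) : Fin m → ℂ)} with hL
  have hLinv : ∀ y : Fin n × Fin n → ℂ, ∀ w ∈ L, (N.map (MvPolynomial.eval y)).mulVec w ∈ L := by
    intro y w _
    have : (N.map (MvPolynomial.eval y)).mulVec w = 0 := by
      change (pointMat N y).mulVec w = 0
      rw [h0 y, Matrix.zero_mulVec]
    rw [this]; exact L.zero_mem
  rcases hirr L hLinv with hbot | htop
  · have hmem : (Pi.single i0 (1 : ℂ) : Fin m → ℂ) ∈ L := Submodule.subset_span rfl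
    rw [hbot, Submodule.mem_bot] at hmem
    have := congr_fun hmem i0
    simp at this
  · have hmem : (Pi.single i1 (1 : ℂ) : Fin m → ℂ) ∈ L := by rw [htop]; exact Submodule.mem_top
    rw [hL, Submodule.mem_span_singleton] at hmem
    obtain ⟨c, hc⟩ := hmem
    have := congr_fun hc i1
    have hne : i1 ≠ i0 := by
      intro h; have := congrArg Fin.val h; simp [hi0, hi1] at this
    simp [hne] at this

/-- The same in index form: an `IrreducibleInv` affine pencil of size `b ≥ 2` is NOT square-zero. -/
theorem sq_ne_zero_of_irreducibleInv (N : AffMat n m) (hN : IsAffine N) (hirr : IrreducibleInv N) (hm : 2 ≤ m) :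
    N ^ 2 ≠ 0 := fun h2 =>
  absurd (le_one_of_irreducibleInv_of_sq_eq_zero N hN h2 hirr) (by omega)

end Summit.ValiantsHypothesis.ValiantsHypothesis.Theorems.GrenetZeon.NilSpaceSandwich

end
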